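import Summits.CriticalPhenomena.PercolationContinuityZ3.Theorems.PercNearOneGluingNoHeavyLowerTailOneCutFivePocketSym
import Summits.CriticalPhenomena.PercolationContinuityZ3.Theorems.PercNearOneGluingNoHeavyLowerTailOneCutFivePocketHalfRefutation

/-!
# `NoHeavyLowerTail` (stmt-CriticalPhenomena-4575), |A| = 5 glued rung: the TIED pocket exchange (POCKET-½ at the tie `q_a = q_b`)
# is FALSE as well

Support file (prover seat `prim-ineq-gen-8`, gen 7; `--supports stmt-CriticalPhenomena-4575`).  The tie reduction
`OneCutFive.pocketHalf_of_pocketHalfTie` (this seat gen 5, p204941) shows that (POCKET-½) follows from its restriction to the tie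
`q_a = q_b ≤ q_c`, `q_a ≥ ½`; since (POCKET-½) is false (`OneCutFivePocketHalfRefutation.not_pocketHalf`, p206698: the five-vertex
star-plus-hub witness), so is the tied form — `not_pocketHalfTie`.  Equivalently: there is a finite weighted graph and distinct
`o, a, b, c` with `½ ≤ μ(o↔a) = μ(o↔b) ≤ μ(o↔c)` and `μ(B = {a}) > μ(B = {b,c})` (by the tie reduction such a graph is obtained from the
witness by raising the weight of the pair `(o,a)` until the first tie).  Memo: `run/shared/lean/prim/prim-ineq-gen-8/FINDING-gen7-CORE.md` §7.
-/

namespace Summit.CriticalPhenomena.PercolationContinuityZ3.Theorems.OneCutFivePocketTieRefutation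

open MeasureTheory Literature.Probability.Percolation Literature.Probability.LatticeModels

/-- **The tied pocket exchange is false**: it is not the case that for all finite weighted graphs and distinct `o, a, b, c` with
`½ ≤ μ(o↔a) = μ(o↔b) ≤ μ(o↔c)` one has `μ(B = {a}) ≤ μ(B = {b,c})` (else `pocketHalf_of_pocketHalfTie` would give (POCKET-½),
refuted by `not_pocketHalf`). [this work] -/
theorem not_pocketHalfTie : ¬ ∀ (n : ℕ) (w : Sym2 (Fin n) → unitInterval) (o a b c : Fin n),
    o ≠ a → o ≠ b → o ≠ c → a ≠ b → a ≠ c → b ≠ c →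
    1 / 2 ≤ (prodBernoulli w).real (openConn o a) →
    (prodBernoulli w).real (openConn o a) = (prodBernoulli w).real (openConn o b) →
    (prodBernoulli w).real (openConn o b) ≤ (prodBernoulli w).real (openConn o c) →
    (prodBernoulli w).real {ω : BondConfig (Fin n) | ω ∈ openConn o a ∧ ω ∉ openConn o b ∧ ω ∉ openConn o c} ≤
      (prodBernoulli w).real {ω : BondConfig (Fin n) | ω ∉ openConn o a ∧ ω ∈ openConn o b ∧ ω ∈ openConn o c} := by
  intro hT
  exact OneCutFivePocketHalfRefutation.not_pocketHalf fun n w o a b c hoa hob hoc hab hac hbc hhalf hab' hac' =>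
    OneCutFive.pocketHalf_of_pocketHalfTie hT w o a b c hoa hob hoc hab hac hbc hhalf hab' hac'

end Summit.CriticalPhenomena.PercolationContinuityZ3.Theorems.OneCutFivePocketTieRefutation
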